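import Summits.CriticalPhenomena.CardyFormulaZ2.Theorems.CardyMeckeFlipLawToCrossingsDual
import Literature.Probability.Percolation.QuadCrossingSubseqLimits
import Literature.Probability.Percolation.QuadCrossingContinuityEventsProofs
import HarnessLib

/-!
# Stub S3b `stub_oneQuadDualityGe` of crux `Z2LimitsSymmetric` — one-quad duality in the limit, `≥`

Crux `Z2LimitsSymmetric` (stmt-CriticalPhenomena-14827) of route `CardyMeckeFlip`, sub-problem
`CardyFormulaZ2`, line `registered` (`Cruxes/Z2LimitsSymmetric/Lines/birth.lean`), stub S3b.

Let `Λ = subseqQuadLimits univ` be the set of weak subsequential limits of the laws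
`μ_δ = z2QuadLaw univ δ` of the Schramm–Smirnov configuration `S_ω` of critical bond percolation on
`δℤ²`, on the Schramm–Smirnov space `ℋ_ℂ = QuadConfig univ`; `⊞_Q = crossedEvent Q = {S | Q ∈ S}` is
closed.  For a plane homeomorphism `H` put `Q = rectQuad H 1 1` (the square `[-1, 1]²` read through
`H`, crossed from `H(left edge)` to `H(right edge)`) and `Q† = rectQuad (rotI.trans H) 1 1`
(`rotI = Homeomorph.mulLeft₀ I _`; same carrier, crossed from `H(bottom)` to `H(top)`).

**Theorem `stub_oneQuadDualityGe`.**  For every `μ ∈ Λ` and every `H`, `1 ≤ μ(⊞_Q) + μ(⊞_{Q†})`.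

Proof.  Fix `ε > 0`.
* `exists_shrink_measure_crossedEvent_le` gives `s'' ∈ (0, 1/2]` with
  `μ ⊞_{rectQuad H (1-s'') (1+s'')} ≤ μ ⊞_Q + ε`; put `s = r = s''/4`.
* Lattice level (`prob_not_crossed_le_z2QuadLaw`, tree): for `δ < δ₀`,
  `P[Q†⁺ ∉ S_ω] ≤ μ_δ(⊞_{Q⁻})` with `Q†⁺ = rectQuad (rotI.trans H) (1+s) (1-s)` and
  `Q⁻ = rectQuad H ((1-s)(1-r)) ((1+s)(1+r))`; since `P[Q†⁺ ∉ S_ω] = 1 - μ_δ(⊞_{Q†⁺})`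
  (`z2QuadLaw_apply`, `μ_δ` a probability measure), `1 ≤ μ_δ(⊞_{Q†⁺}) + μ_δ(⊞_{Q⁻})`
  (`one_le_add_of_prob_not_crossed_le`).
* Both crossing events are closed, so along the defining meshes `δₖ → 0⁺` of `μ` the closed-set half
  of the portmanteau theorem (`QuadConfig.hasOuterApproxClosed`,
  `FiniteMeasure.limsup_measure_closed_le_of_tendsto`) gives `1 ≤ μ(⊞_{Q†⁺}) + μ(⊞_{Q⁻})`
  (`one_le_measure_add_of_small_mesh`).
* `Q† < Q†⁺` and `rectQuad H (1-s'') (1+s'') < Q⁻` strictly (`Quad.strictlyDominated_rectQuad`), so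
  `⊞_{Q†⁺} ⊆ ⊞_{Q†}` and `⊞_{Q⁻} ⊆ ⊞_{rectQuad H (1-s'') (1+s'')}`; hence
  `1 ≤ μ ⊞_{Q†} + μ ⊞_Q + ε`, and `ε → 0` (`ENNReal.le_of_forall_pos_le_add`).

References: O. Schramm, S. Smirnov, Ann. Probab. 39 (2011), §1.1 and proof of Lemma 6.1;
C. Garban, G. Pete, O. Schramm, arXiv:1008.1378, §2.3.
-/

noncomputable section

open MeasureTheory Filter Set Topology
open scoped ENNReal NNReal unitInterval
open Literature.Probability.Percolation Literature.Probability.Percolation.QuadCrossing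
open Literature.Probability.LatticeModels
open Summit.CriticalPhenomena.CardyFormulaZ2.Theorems.MeckeFlipBridge

namespace Summit.CriticalPhenomena.CardyFormulaZ2.Cruxes.Z2LimitsSymmetric

/-! ### Lattice level: complementary events -/

/-- **Per-mesh duality inequality.**  For `δ > 0` and quads `Qp`, `Qm` of the plane: if
`P_{1/2}[Qp ∉ S_ω] ≤ μ_δ(⊞_{Qm})` then `1 ≤ μ_δ(⊞_{Qp}) + μ_δ(⊞_{Qm})` — `μ_δ` is a probability
measure (`isProbabilityMeasure_z2QuadLaw_of_pos`) and `μ_δ((⊞_{Qp})ᶜ) = P_{1/2}[Qp ∉ S_ω]`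
(`z2QuadLaw_apply`). -/
theorem one_le_add_of_prob_not_crossed_le {δ : ℝ} (hδ : 0 < δ) (Qp Qm : Quad (univ : Set ℂ))
    (h : bondPercolation (zdGraph 2) half {ω | Qp ∉ z2QuadConfig univ δ ω} ≤
      (z2QuadLaw (univ : Set ℂ) δ : Measure (QuadConfig (univ : Set ℂ))) (QuadConfig.crossedEvent Qm)) :
    (1 : ℝ≥0∞) ≤
      (z2QuadLaw (univ : Set ℂ) δ : Measure (QuadConfig (univ : Set ℂ))) (QuadConfig.crossedEvent Qp) +
        (z2QuadLaw (univ : Set ℂ) δ : Measure (QuadConfig (univ : Set ℂ)))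
          (QuadConfig.crossedEvent Qm) := by
  haveI := isProbabilityMeasure_z2QuadLaw_of_pos (D := (univ : Set ℂ)) isOpen_univ hδ
  have hc : (z2QuadLaw (univ : Set ℂ) δ : Measure (QuadConfig (univ : Set ℂ)))
      (QuadConfig.crossedEvent Qp)ᶜ ≤
      (z2QuadLaw (univ : Set ℂ) δ : Measure (QuadConfig (univ : Set ℂ))) (QuadConfig.crossedEvent Qm) := by
    rw [z2QuadLaw_apply isOpen_univ hδ (QuadConfig.measurableSet_crossedEvent Qp).compl]
    exact h
  calc (1 : ℝ≥0∞)
      = (z2QuadLaw (univ : Set ℂ) δ : Measure (QuadConfig (univ : Set ℂ))) univ := measure_univ.symm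
    _ = (z2QuadLaw (univ : Set ℂ) δ : Measure (QuadConfig (univ : Set ℂ))) (QuadConfig.crossedEvent Qp) +
          (z2QuadLaw (univ : Set ℂ) δ : Measure (QuadConfig (univ : Set ℂ)))
            (QuadConfig.crossedEvent Qp)ᶜ :=
        (measure_add_measure_compl (QuadConfig.measurableSet_crossedEvent Qp)).symm
    _ ≤ _ := add_le_add le_rfl hc

/-! ### Portmanteau: the per-mesh inequality survives in every sublimit -/

/-- **Closed crossing events keep the lattice inequality in the limit.**  If `μ ∈ Λ` and
`1 ≤ μ_δ(⊞_{Q₁}) + μ_δ(⊞_{Q₂})` for all `0 < δ < δ₀`, then `1 ≤ μ(⊞_{Q₁}) + μ(⊞_{Q₂})`: along the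
defining meshes `δₖ → 0⁺` of `μ` (`isSubseqQuadLimit_iff`) the bound holds eventually, both events
are closed (`QuadConfig.isClosed_crossedEvent`), and the closed-set half of the portmanteau theorem
on the metrisable `ℋ_ℂ` (`QuadConfig.hasOuterApproxClosed`,
`FiniteMeasure.limsup_measure_closed_le_of_tendsto`) bounds each `limsup`; an `ε/2 + ε/2` argument
(`eventually_lt_of_limsup_lt`, `ENNReal.le_of_forall_pos_le_add`) combines the two. -/
theorem one_le_measure_add_of_small_mesh {μ : FiniteMeasure (QuadConfig (univ : Set ℂ))}
    (hμ : μ ∈ subseqQuadLimits (univ : Set ℂ)) (Q₁ Q₂ : Quad (univ : Set ℂ))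
    (h : ∃ δ₀ : ℝ, 0 < δ₀ ∧ ∀ δ : ℝ, 0 < δ → δ < δ₀ → (1 : ℝ≥0∞) ≤
      (z2QuadLaw (univ : Set ℂ) δ : Measure (QuadConfig (univ : Set ℂ))) (QuadConfig.crossedEvent Q₁) +
        (z2QuadLaw (univ : Set ℂ) δ : Measure (QuadConfig (univ : Set ℂ)))
          (QuadConfig.crossedEvent Q₂)) :
    (1 : ℝ≥0∞) ≤ (μ : Measure (QuadConfig (univ : Set ℂ))) (QuadConfig.crossedEvent Q₁) +
      (μ : Measure (QuadConfig (univ : Set ℂ))) (QuadConfig.crossedEvent Q₂) := by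
  haveI : HasOuterApproxClosed (QuadConfig (univ : Set ℂ)) :=
    QuadConfig.hasOuterApproxClosed isOpen_univ univ_nonempty
  obtain ⟨δs, hpos, hδ0, hlim⟩ := (isSubseqQuadLimit_iff univ μ).mp hμ
  obtain ⟨δ₀, hδ₀, h⟩ := h
  -- the inequality along the defining meshes
  have hev : ∀ᶠ k in atTop, (1 : ℝ≥0∞) ≤
      (z2QuadLaw (univ : Set ℂ) (δs k) : Measure (QuadConfig (univ : Set ℂ)))
          (QuadConfig.crossedEvent Q₁) +
        (z2QuadLaw (univ : Set ℂ) (δs k) : Measure (QuadConfig (univ : Set ℂ)))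
          (QuadConfig.crossedEvent Q₂) := by
    filter_upwards [hδ0.eventually (Iio_mem_nhds hδ₀)] with k hk
    exact h (δs k) (hpos k) hk
  -- closed-set portmanteau, for each event
  have h₁ : atTop.limsup (fun k =>
      (z2QuadLaw (univ : Set ℂ) (δs k) : Measure (QuadConfig (univ : Set ℂ)))
        (QuadConfig.crossedEvent Q₁)) ≤
      (μ : Measure (QuadConfig (univ : Set ℂ))) (QuadConfig.crossedEvent Q₁) :=
    FiniteMeasure.limsup_measure_closed_le_of_tendsto hlim (QuadConfig.isClosed_crossedEvent Q₁)
  have h₂ : atTop.limsup (fun k =>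
      (z2QuadLaw (univ : Set ℂ) (δs k) : Measure (QuadConfig (univ : Set ℂ)))
        (QuadConfig.crossedEvent Q₂)) ≤
      (μ : Measure (QuadConfig (univ : Set ℂ))) (QuadConfig.crossedEvent Q₂) :=
    FiniteMeasure.limsup_measure_closed_le_of_tendsto hlim (QuadConfig.isClosed_crossedEvent Q₂)
  refine ENNReal.le_of_forall_pos_le_add fun ε hε _ => ?_
  have hε2 : (ε : ℝ≥0∞) / 2 ≠ 0 := (ENNReal.half_pos (ENNReal.coe_pos.mpr hε).ne').ne'
  have hlt₁ := h₁.trans_lt (ENNReal.lt_add_right (measure_ne_top _ _) hε2)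
  have hlt₂ := h₂.trans_lt (ENNReal.lt_add_right (measure_ne_top _ _) hε2)
  obtain ⟨k, hk, hk₁, hk₂⟩ :=
    (hev.and ((eventually_lt_of_limsup_lt hlt₁).and (eventually_lt_of_limsup_lt hlt₂))).exists
  calc (1 : ℝ≥0∞)
      ≤ (z2QuadLaw (univ : Set ℂ) (δs k) : Measure (QuadConfig (univ : Set ℂ)))
          (QuadConfig.crossedEvent Q₁) +
        (z2QuadLaw (univ : Set ℂ) (δs k) : Measure (QuadConfig (univ : Set ℂ)))
          (QuadConfig.crossedEvent Q₂) := hk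
    _ ≤ ((μ : Measure (QuadConfig (univ : Set ℂ))) (QuadConfig.crossedEvent Q₁) + ε / 2) +
        ((μ : Measure (QuadConfig (univ : Set ℂ))) (QuadConfig.crossedEvent Q₂) + ε / 2) :=
        add_le_add hk₁.le hk₂.le
    _ = (μ : Measure (QuadConfig (univ : Set ℂ))) (QuadConfig.crossedEvent Q₁) +
        (μ : Measure (QuadConfig (univ : Set ℂ))) (QuadConfig.crossedEvent Q₂) + ε := by
        rw [add_add_add_comm, ENNReal.add_halves]

/-- **The limit inequality for the perturbed quads.**  For `μ ∈ Λ`, a plane homeomorphism `H` and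
`s, r ∈ (0, 1/2]`: `1 ≤ μ(⊞_{Q†⁺}) + μ(⊞_{Q⁻})` with `Q†⁺ = rectQuad (rotI.trans H) (1+s) (1-s)`
(the harder transposed quad) and `Q⁻ = rectQuad H ((1-s)(1-r)) ((1+s)(1+r))` (the easier quad) —
`prob_not_crossed_le_z2QuadLaw` at lattice level, then the two lemmas above. -/
theorem one_le_measure_add_perturbed {μ : FiniteMeasure (QuadConfig (univ : Set ℂ))}
    (hμ : μ ∈ subseqQuadLimits (univ : Set ℂ)) (H : ℂ ≃ₜ ℂ) {s r : ℝ} (hs : 0 < s)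
    (hs' : s ≤ 1 / 2) (hr : 0 < r) (hr' : r ≤ 1 / 2) :
    (1 : ℝ≥0∞) ≤ (μ : Measure (QuadConfig (univ : Set ℂ))) (QuadConfig.crossedEvent
        (Quad.rectQuad ((Homeomorph.mulLeft₀ Complex.I Complex.I_ne_zero).trans H) (1 + s) (1 - s)
          (by linarith) (by linarith) (fun _ => mem_univ _))) +
      (μ : Measure (QuadConfig (univ : Set ℂ))) (QuadConfig.crossedEvent
        (Quad.rectQuad (D := (univ : Set ℂ)) H ((1 - s) * (1 - r)) ((1 + s) * (1 + r))
          (mul_pos (by linarith) (by linarith)) (mul_pos (by linarith) (by linarith))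
          (fun _ => mem_univ _))) := by
  obtain ⟨δ₀, hδ₀, h⟩ := prob_not_crossed_le_z2QuadLaw H hs hs' hr hr'
  exact one_le_measure_add_of_small_mesh hμ _ _
    ⟨δ₀, hδ₀, fun δ hδ hδlt => one_le_add_of_prob_not_crossed_le hδ _ _ (h δ hδ hδlt)⟩

/-! ### The stub -/

/-- **S3b — one-quad duality in the limit, the `≥` half.**  For every subsequential quad-crossing
scaling limit `μ ∈ Λ = subseqQuadLimits univ` of critical bond percolation on `δℤ²` and every plane
homeomorphism `H`, with `Q = rectQuad H 1 1` (crossed `H(left) ↔ H(right)`) and its transpose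
`Q† = rectQuad (rotI.trans H) 1 1` (crossed `H(bottom) ↔ H(top)`): `1 ≤ μ(⊞_Q) + μ(⊞_{Q†})`.
Proof: `one_le_measure_add_perturbed` with `s = r = s''/4`, monotonicity of the crossing events
along Schramm–Smirnov's order (`Quad.strictlyDominated_rectQuad`,
`QuadConfig.crossedEvent_subset_of_strictlyDominated`), the shrink continuity
`exists_shrink_measure_crossedEvent_le`, and `ε → 0`. -/
theorem stub_oneQuadDualityGe : open Literature.Probability.Percolation.QuadCrossing in ∀ μ ∈ Literature.Probability.Percolation.QuadCrossing.subseqQuadLimits (Set.univ : Set ℂ), ∀ H : ℂ ≃ₜ ℂ, (1 : ENNReal) ≤ ((μ : MeasureTheory.FiniteMeasure (QuadConfig (Set.univ : Set ℂ))) : MeasureTheory.Measure (QuadConfig (Set.univ : Set ℂ))) (QuadConfig.crossedEvent (Quad.rectQuad H 1 1 one_pos one_pos (fun _ => Set.mem_univ _))) + ((μ : MeasureTheory.FiniteMeasure (QuadConfig (Set.univ : Set ℂ))) : MeasureTheory.Measure (QuadConfig (Set.univ : Set ℂ))) (QuadConfig.crossedEvent (Quad.rectQuad ((Homeomorph.mulLeft₀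 Complex.I Complex.I_ne_zero).trans H) 1 1 one_pos one_pos (fun _ => Set.mem_univ _))) := by
  intro μ hμ H
  refine ENNReal.le_of_forall_pos_le_add fun ε hε _ => ?_
  have hε' : (0 : ℝ≥0∞) < ε := ENNReal.coe_pos.mpr hε
  -- shrink continuity at `Q`
  obtain ⟨s'', hs'', hs''2, hshrink⟩ :=
    exists_shrink_measure_crossedEvent_le H (μ : Measure (QuadConfig (univ : Set ℂ))) hε'
  -- the perturbation parameter `s = r = s''/4`
  obtain ⟨s, hs, hs', hlo, hhi⟩ : ∃ s : ℝ, 0 < s ∧ s ≤ 1 / 2 ∧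
      1 - s'' < (1 - s) * (1 - s) ∧ (1 + s) * (1 + s) < 1 + s'' :=
    ⟨s'' / 4, by positivity, by linarith, by nlinarith, by nlinarith⟩
  have key := one_le_measure_add_perturbed hμ H hs hs' hs hs'
  -- `Q† < Q†⁺`, so `⊞_{Q†⁺} ⊆ ⊞_{Q†}`
  have h₁ : (μ : Measure (QuadConfig (univ : Set ℂ))) (QuadConfig.crossedEvent
        (Quad.rectQuad ((Homeomorph.mulLeft₀ Complex.I Complex.I_ne_zero).trans H) (1 + s) (1 - s)
          (by linarith) (by linarith) (fun _ => mem_univ _))) ≤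
      (μ : Measure (QuadConfig (univ : Set ℂ))) (QuadConfig.crossedEvent
        (Quad.rectQuad ((Homeomorph.mulLeft₀ Complex.I Complex.I_ne_zero).trans H) 1 1
          one_pos one_pos (fun _ => mem_univ _))) :=
    measure_mono (QuadConfig.crossedEvent_subset_of_strictlyDominated
      (Quad.strictlyDominated_rectQuad ((Homeomorph.mulLeft₀ Complex.I Complex.I_ne_zero).trans H)
        (a₁ := 1) (a₂ := 1 + s) (b₁ := 1) (b₂ := 1 - s) one_pos (by linarith) (by linarith)
        (by linarith) (fun _ => mem_univ _) (fun _ => mem_univ _)))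
  -- `rectQuad H (1-s'') (1+s'') < Q⁻`, so `⊞_{Q⁻} ⊆ ⊞_{rectQuad H (1-s'') (1+s'')}`
  have h₂ : (μ : Measure (QuadConfig (univ : Set ℂ))) (QuadConfig.crossedEvent
        (Quad.rectQuad (D := (univ : Set ℂ)) H ((1 - s) * (1 - s)) ((1 + s) * (1 + s))
          (mul_pos (by linarith) (by linarith)) (mul_pos (by linarith) (by linarith))
          (fun _ => mem_univ _))) ≤
      (μ : Measure (QuadConfig (univ : Set ℂ))) (QuadConfig.crossedEvent
        (Quad.rectQuad H (1 - s'') (1 + s'') (by linarith) (by linarith) (fun _ => mem_univ _))) :=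
    measure_mono (QuadConfig.crossedEvent_subset_of_strictlyDominated
      (Quad.strictlyDominated_rectQuad H (a₁ := 1 - s'') (a₂ := (1 - s) * (1 - s))
        (b₁ := 1 + s'') (b₂ := (1 + s) * (1 + s)) (by linarith) hlo
        (mul_pos (by linarith) (by linarith)) hhi (fun _ => mem_univ _) (fun _ => mem_univ _)))
  calc (1 : ℝ≥0∞) ≤ _ := key
    _ ≤ (μ : Measure (QuadConfig (univ : Set ℂ))) (QuadConfig.crossedEvent
          (Quad.rectQuad ((Homeomorph.mulLeft₀ Complex.I Complex.I_ne_zero).trans H) 1 1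
            one_pos one_pos (fun _ => mem_univ _))) +
        ((μ : Measure (QuadConfig (univ : Set ℂ))) (QuadConfig.crossedEvent
          (Quad.rectQuad H 1 1 one_pos one_pos (fun _ => mem_univ _))) + ε) :=
        add_le_add h₁ (h₂.trans hshrink)
    _ = _ := by rw [← add_assoc, add_comm (_ : ℝ≥0∞) ((μ : Measure (QuadConfig (univ : Set ℂ)))
          (QuadConfig.crossedEvent (Quad.rectQuad H 1 1 one_pos one_pos (fun _ => mem_univ _))))]

end Summit.CriticalPhenomena.CardyFormulaZ2.Cruxes.Z2LimitsSymmetric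

end
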